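import Summits.BirchSwinnertonDyer.BirchSwinnertonDyer.Theorems.PrintX11aUpperNonSurjThreeMultDivisibilityAtOfConjA
import Summits.BirchSwinnertonDyer.BirchSwinnertonDyer.Theorems.ErratumRoadFiveNonSurjCornerTwinKatoEngine
import Summits.BirchSwinnertonDyer.Rank1Residual.X2.ClassClosureEntireFree
import HarnessLib

/-!
# Route `PrintX11a`, crux U3 `UpperNonSurjThree` (item stmt-BirchSwinnertonDyer-20613), line «finemu3»: the PER-PAIR
# (A)-DOOR — statement (A) at a rank-`0` multiplicative pair gives the Euler-system half `ord_p #Ш ≤ ord_p #Ш_an`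

Seat `bsd-line-x11a-p2` (D-0154 KEY (146)/(147)(e)); `--supports stmt-BirchSwinnertonDyer-20613` (helper). Theses-free.
BSD is not proved by any of this; nothing is asserted about any curve; every theorem is CONDITIONAL on its displayed
hypotheses (the PUBLISHED facts Stein–Wuthrich 2013 Thm. 6.1, GZK, modularity, Greenberg–Stevens, Kato Thm. 12.4,
Kato's §17.13 inputs at `p ∥ N` incl. the fine package — CONSTRUCTION facts, flags `Kato-17.11-at-{nonsplit,split}-mult`,
`Kato-p280-image-at-mult`, R-48 —, Greenberg 1999 Thm. 1.5, Wuthrich 2014 Cor. 18, and statement (A) AT THE PAIR).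

WHAT. The transfer `X11b.multDivisibilityAt_of_katoFacts_of_conjAAt` (p606949) composed with the K2 cell's rank-`0`
engine `X11b.missingUpperBoundAt_of_multDivisibilityAt_of_analyticRank_eq_zero` gives the (A)-road's PER-PAIR DOOR, the
analogue of the μ-road's `X11a.missingUpperBoundAt_of_muAnZeroAt_of_analyticRank_eq_zero` (file `PrintX11aMuCosetDoor.lean`)
with the analytic `μ`-certificate replaced by `ConjAAt W p` — and with NO image bit at all (the μ-road needs `¬Surj`
for its Kolyvagin core; the (A)-road needs only `Irr(E[p])`, for the p. 280 image clause):

* §1 `X11b.missingUpperBoundAt_of_conjAAt_of_analyticRank_eq_zero` (class-free: odd multiplicative `p`, `E[p]`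
  irreducible, `ord_{s=1} L(E,s) = 0`, (A) at the pair ⟹ `Typed.MissingUpperBoundAt W p`) and its non-split form
  (Greenberg–Stevens vacuous);
* §2 the class forms on `ClassX11a` (incl. `BSD(E,p)` when `#Ш_an` is a `p`-adic unit: lower half free, GZK —
  the μ-road's `X11a.bsdp_of_upper_of_unit_of_analyticRank_eq_zero` inlined) and the BODY of the child cruxes U3/U5 at a pair from (A) at that pair
  (`upperNonSurj_body_of_conjAAt`: facts → `∀ W p, ClassX11a W p → ConjAAt W p → MissingUpperBoundAt W p` — no
  `¬Surj`, no `p = 3` / `5 ≤ p` binder needed), and the line's composition BY CONTENT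
  (`upperNonSurjThree_body_of_conjA_onDomain`: facts → (A) on the U3 domain → the body of `UpperNonSurjThree`),
  which the lead's `UpperNonSurjThree_of` can `exact` once `stub_pubFactsAn` is unpacked.

CONSUMER. Per pair, `ConjAAt W 3` is a finite class-group certificate on `ℚ(E[3])` through
`DeoRaySujatha2023.thm39_of_homTrivial_of_classNumber_stabilizerField` (modulo that ONE named fact; typer ty3 g5's
two-engine census of the 12 U3 pairs `726f1 … 18150x1`); this file is the door such a certificate walks through.
Class-wide, (A) on the U3 domain is OPEN (stub `stub_conjA_three`, Iwasawa-`μ` type) — untouched here.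

HONEST FRAMING. Theorems only (no `def`, no named fact minted, no `sorry`); item 20613 does NOT close; PARTITION 0;
beyond-print theorem: the door inherits p606949's (Kato's integral divisibility at `p ∥ N` without (12.5.4), modulo (A)).

References: [Kato2004Asterisque] Thm. 12.4 (p. 221), Thm. 17.4 (p. 273), §17.13 (pp. 279–280); [CoatesSujatha2005] §3
statement (A), Thm. 3.4; [DeoRaySujatha2023] Thm. 3.9; [SteinWuthrich2013] Thm. 6.1 (p. 20), §4.2; [GreenbergStevens1993]
(trivial zero); [Wuthrich2014] Cor. 18 (p. 398); [Miller2011LMS] Def. 1.1; tree `Theorems/PrintX11aMuCosetDoor.lean` (μ-road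
twin), `Theorems/ErratumRoadFiveNonSurjCornerTwinKatoEngine.lean` (engine), p606949.
-/

set_option autoImplicit false
set_option linter.dupNamespace false

noncomputable section

open scoped Classical NumberField MatrixGroups ModularForm

open CongruenceSubgroup WeierstrassCurve Field Literature.NumberTheory.EllipticCurves
  Literature.NumberTheory.EllipticCurves.ModularForms Literature.NumberTheory.EllipticCurves.Kato2004
  Literature.NumberTheory.EllipticCurves.Rank1Residual Literature.NumberTheory.EllipticCurves.Rank1Residual.Typed
  Literature.NumberTheory.EllipticCurves.Wuthrich2014 Literature.NumberTheory.EllipticCurves.SteinWuthrich2013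
  Literature.NumberTheory.EllipticCurves.Greenberg1999 Summit.BirchSwinnertonDyer.Rank1Residual

namespace Summit.BirchSwinnertonDyer.Rank1Residual.X11b

/-! ### §1 Class-free per-pair doors -/

section ClassFree

variable (W : WeierstrassCurve ℚ) [W.IsElliptic] [W.IsGloballyMinimal] (p : ℕ) [Fact p.Prime]

/-- **PER-PAIR (A)-DOOR, class-free.** At an ODD prime `p` of multiplicative reduction with `E[p]` irreducible and
`ord_{s=1} L(E,s) = 0`: statement (A) at the pair (`ConjAAt W p`) gives `Typed.MissingUpperBoundAt W p`
(`ord_p #Ш ≤ ord_p #Ш_an`), modulo Stein–Wuthrich Thm. 6.1 (`hJs`/`hJn`), GZK (`hGZK`), modularity (`hpar`), Kato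
Thm. 12.4 (`h12`), the §17.13 inputs at `p ∥ N` (`hns`, `hsp`, `hfine`), Greenberg Thm. 1.5 (`h15`), Wuthrich Cor. 18
(`h18`) and Greenberg–Stevens (`hGS`); Kato (12.2.1) and the entire continuation are tree theorems.  NO image bit,
no (ram), no `μ`.  Transfer `multDivisibilityAt_of_katoFacts_of_conjAAt` + engine
`missingUpperBoundAt_of_multDivisibilityAt_of_analyticRank_eq_zero`.
[cite: Kato2004Asterisque, Thm. 17.4 (p. 273) and §17.13 (pp. 279–280)] [cite: CoatesSujatha2005, §3 statement (A)]
[cite: SteinWuthrich2013, Thm. 6.1 (p. 20)] [cite: Wuthrich2014, Cor. 18 (p. 398)] [cite: Miller2011LMS, Def. 1.1] -/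
theorem missingUpperBoundAt_of_conjAAt_of_analyticRank_eq_zero
    (hJs : thm61_splitMultiplicative) (hJn : thm61_nonsplitMultiplicative)
    (hGZK : rank_eq_analyticRank_of_analyticRank_le_one) (hpar : nonempty_modularParametrizationData)
    (h12 : Kato2004.thm12_4)
    (hns : Kato2004.exists_multDivisibilityInputs_nonsplit)
    (hsp : Kato2004.exists_multDivisibilityInputs_split)
    (h15 : thm15_isTorsion_multiplicative_rat)
    (h18 : Wuthrich2014.corollary18_padicLFunction_mem_iwasawaAlgebra_multiplicative)
    (hfine : Kato2004.exists_multDivisibilityInputs_fine)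
    (hGS : greenberg_stevens (W := W) (p := p))
    (hp2 : p ≠ 2) (hr : W.analyticRank = 0) (hmult : W.HasMultiplicativeReductionAtPrime p)
    (hirr : W.HasIrreducibleModPGaloisRep p) (hA : ConjAAt W p) :
    MissingUpperBoundAt W p :=
  missingUpperBoundAt_of_multDivisibilityAt_of_analyticRank_eq_zero hJs hJn hGZK
    (X2.ClassClosureEntireFree.hasEntireLFunction_rat_of_nonempty_modularParametrizationData hpar) hpar W p
    hGS hp2 hmult hr
    (multDivisibilityAt_of_katoFacts_of_conjAAt Kato2004.nonempty_iwasawaH1Data_holds h12 hns hsp h15 h18 hfine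
      W p hp2 hmult hirr hA)

/-- **PER-PAIR (A)-DOOR, class-free, NON-SPLIT `p`** (Greenberg–Stevens is vacuous: no split Tate parameter).
[cite: Kato2004Asterisque, §17.13 (pp. 279–280)] [cite: CoatesSujatha2005, §3 statement (A)] [cite: SteinWuthrich2013, Thm. 6.1 (p. 20)] -/
theorem missingUpperBoundAt_of_conjAAt_of_analyticRank_eq_zero_of_nonsplit
    (hJs : thm61_splitMultiplicative) (hJn : thm61_nonsplitMultiplicative)
    (hGZK : rank_eq_analyticRank_of_analyticRank_le_one) (hpar : nonempty_modularParametrizationData)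
    (h12 : Kato2004.thm12_4)
    (hns : Kato2004.exists_multDivisibilityInputs_nonsplit)
    (hsp : Kato2004.exists_multDivisibilityInputs_split)
    (h15 : thm15_isTorsion_multiplicative_rat)
    (h18 : Wuthrich2014.corollary18_padicLFunction_mem_iwasawaAlgebra_multiplicative)
    (hfine : Kato2004.exists_multDivisibilityInputs_fine)
    (hp2 : p ≠ 2) (hr : W.analyticRank = 0) (hmult : W.HasMultiplicativeReductionAtPrime p)
    (hirr : W.HasIrreducibleModPGaloisRep p) (hnsp : ¬ W.HasSplitMultiplicativeReductionAtPrime p)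
    (hA : ConjAAt W p) : MissingUpperBoundAt W p :=
  missingUpperBoundAt_of_conjAAt_of_analyticRank_eq_zero W p hJs hJn hGZK hpar h12 hns hsp h15 h18 hfine
    (fun Dq ↦ absurd Dq.split hnsp) hp2 hr hmult hirr hA

end ClassFree

/-! ### §2 The class forms on `ClassX11a` and the bodies of U3/U5 at a pair -/

section OnClass

/-- **(A)-DOOR ON `ClassX11a`** (`r_an = 0 ∧ p ≠ 2 ∧ Mult ∧ Irr ∧ ¬Ram`; `¬Ram` unused): `ConjAAt W p ⟹
Typed.MissingUpperBoundAt W p` modulo the displayed facts — the BODY of the child cruxes `UpperNonSurjThree` /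
`UpperNonSurjFive` at the pair, from (A) at that pair, WITHOUT their `¬Surj` / `p = 3` / `5 ≤ p` binders.
[cite: Kato2004Asterisque, Thm. 17.4 (p. 273) and §17.13 (pp. 279–280)] [cite: CoatesSujatha2005, §3 statement (A)]
[cite: SteinWuthrich2013, Thm. 6.1 (p. 20)] -/
theorem _root_.Summit.BirchSwinnertonDyer.Rank1Residual.ClassX11a.missingUpperBoundAt_of_conjAAt
    (hJs : thm61_splitMultiplicative) (hJn : thm61_nonsplitMultiplicative)
    (hGZK : rank_eq_analyticRank_of_analyticRank_le_one) (hpar : nonempty_modularParametrizationData)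
    (h12 : Kato2004.thm12_4)
    (hns : Kato2004.exists_multDivisibilityInputs_nonsplit)
    (hsp : Kato2004.exists_multDivisibilityInputs_split)
    (h15 : thm15_isTorsion_multiplicative_rat)
    (h18 : Wuthrich2014.corollary18_padicLFunction_mem_iwasawaAlgebra_multiplicative)
    (hfine : Kato2004.exists_multDivisibilityInputs_fine)
    (W : WeierstrassCurve ℚ) [W.IsElliptic] [W.IsGloballyMinimal] (p : ℕ) [Fact p.Prime]
    (hGS : greenberg_stevens (W := W) (p := p)) (hX : ClassX11a W p) (hA : ConjAAt W p) :
    MissingUpperBoundAt W p :=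
  missingUpperBoundAt_of_conjAAt_of_analyticRank_eq_zero W p hJs hJn hGZK hpar h12 hns hsp h15 h18 hfine hGS
    hX.2.1 hX.1 hX.2.2.1 hX.2.2.2.1 hA

/-- **`BSD(E,p)` ON `ClassX11a` from (A) at the pair and a unit `#Ш_an`** (the per-pair booking shape of the
(A)-road: certificate for (A) + displayed `#Ш_an = q`, `ord_p q = 0`; lower half free, `Typed.bsdp_of_missingPPartAt`).
[cite: Miller2011LMS, §1 and Def. 1.1]
[cite: CoatesSujatha2005, §3 statement (A)] [cite: SteinWuthrich2013, Thm. 6.1 (p. 20)] -/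
theorem _root_.Summit.BirchSwinnertonDyer.Rank1Residual.ClassX11a.bsdp_of_conjAAt_of_unit
    (hJs : thm61_splitMultiplicative) (hJn : thm61_nonsplitMultiplicative)
    (hGZK : rank_eq_analyticRank_of_analyticRank_le_one) (hpar : nonempty_modularParametrizationData)
    (h12 : Kato2004.thm12_4)
    (hns : Kato2004.exists_multDivisibilityInputs_nonsplit)
    (hsp : Kato2004.exists_multDivisibilityInputs_split)
    (h15 : thm15_isTorsion_multiplicative_rat)
    (h18 : Wuthrich2014.corollary18_padicLFunction_mem_iwasawaAlgebra_multiplicative)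
    (hfine : Kato2004.exists_multDivisibilityInputs_fine)
    (W : WeierstrassCurve ℚ) [W.IsElliptic] [W.IsGloballyMinimal] (p : ℕ) [Fact p.Prime]
    (hGS : greenberg_stevens (W := W) (p := p)) (hX : ClassX11a W p) (hA : ConjAAt W p)
    {q : ℚ} (hq : shaAn W = (q : ℂ)) (hv : padicValRat p q = 0) : BSDp W p :=
  bsdp_of_missingPPartAt W p hGZK (hX.1.trans_le zero_le_one)
    (missingPPartAt_of_lower_of_upper W p ⟨q, hq, by rw [hv]; exact Nat.cast_nonneg _⟩
      (ClassX11a.missingUpperBoundAt_of_conjAAt hJs hJn hGZK hpar h12 hns hsp h15 h18 hfine W p hGS hX hA))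

/-- **The body of U3/U5 at every pair of `ClassX11a`, from (A) pair by pair** (universally closed form of the class
door; the shape a per-pair certificate programme instantiates). [cite: CoatesSujatha2005, §3 statement (A)]
[cite: Kato2004Asterisque, §17.13 (pp. 279–280)] -/
theorem upperNonSurj_body_of_conjAAt
    (hJs : thm61_splitMultiplicative) (hJn : thm61_nonsplitMultiplicative)
    (hGZK : rank_eq_analyticRank_of_analyticRank_le_one) (hpar : nonempty_modularParametrizationData)
    (hGS : ∀ (W : WeierstrassCurve ℚ) [W.IsElliptic] [W.IsGloballyMinimal] (p : ℕ) [Fact p.Prime],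
      greenberg_stevens (W := W) (p := p))
    (h12 : Kato2004.thm12_4)
    (hns : Kato2004.exists_multDivisibilityInputs_nonsplit)
    (hsp : Kato2004.exists_multDivisibilityInputs_split)
    (h15 : thm15_isTorsion_multiplicative_rat)
    (h18 : Wuthrich2014.corollary18_padicLFunction_mem_iwasawaAlgebra_multiplicative)
    (hfine : Kato2004.exists_multDivisibilityInputs_fine) :
    ∀ (W : WeierstrassCurve ℚ) [W.IsElliptic] [W.IsGloballyMinimal] (p : ℕ) [Fact p.Prime],
      ClassX11a W p → ConjAAt W p → MissingUpperBoundAt W p :=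
  fun W _ _ p _ hX hA ↦
    ClassX11a.missingUpperBoundAt_of_conjAAt hJs hJn hGZK hpar h12 hns hsp h15 h18 hfine W p (hGS W p) hX hA

/-- **Line «finemu3» BY CONTENT: (A) on the U3 domain ⟹ the body of `UpperNonSurjThree`** — the displayed facts
and `∀ W p, ClassX11a W p → ¬ Surj W p → p = 3 → ConjAAt W p` (= `stub_conjA_three`) give
`∀ W p, ClassX11a W p → ¬ Surj W p → p = 3 → Typed.MissingUpperBoundAt W p` (= the crux with its binders, Theses-free);
the lead's `UpperNonSurjThree_of` is this after unpacking `stub_pubFactsAn`.  CONDITIONAL; closes nothing.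
[cite: CoatesSujatha2005, §3 statement (A)] [cite: Kato2004Asterisque, §17.13 (pp. 279–280)] -/
theorem upperNonSurjThree_body_of_conjA_onDomain
    (hJs : thm61_splitMultiplicative) (hJn : thm61_nonsplitMultiplicative)
    (hGZK : rank_eq_analyticRank_of_analyticRank_le_one) (hpar : nonempty_modularParametrizationData)
    (hGS : ∀ (W : WeierstrassCurve ℚ) [W.IsElliptic] [W.IsGloballyMinimal] (p : ℕ) [Fact p.Prime],
      greenberg_stevens (W := W) (p := p))
    (h12 : Kato2004.thm12_4)
    (hns : Kato2004.exists_multDivisibilityInputs_nonsplit)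
    (hsp : Kato2004.exists_multDivisibilityInputs_split)
    (h15 : thm15_isTorsion_multiplicative_rat)
    (h18 : Wuthrich2014.corollary18_padicLFunction_mem_iwasawaAlgebra_multiplicative)
    (hfine : Kato2004.exists_multDivisibilityInputs_fine)
    (hA : ∀ (W : WeierstrassCurve ℚ) [W.IsElliptic] [W.IsGloballyMinimal] (p : ℕ) [Fact p.Prime],
      ClassX11a W p → ¬ Surj W p → p = 3 → ConjAAt W p) :
    ∀ (W : WeierstrassCurve ℚ) [W.IsElliptic] [W.IsGloballyMinimal] (p : ℕ) [Fact p.Prime],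
      ClassX11a W p → ¬ Surj W p → p = 3 → MissingUpperBoundAt W p :=
  fun W _ _ p _ hX hnsj hp3 ↦
    ClassX11a.missingUpperBoundAt_of_conjAAt hJs hJn hGZK hpar h12 hns hsp h15 h18 hfine W p (hGS W p) hX
      (hA W p hX hnsj hp3)

/-- **Line «finemu5» BY CONTENT: (A) on the U5 domain ⟹ the body of `UpperNonSurjFive`** (`5 ≤ p` in place of
`p = 3`; same door). CONDITIONAL; closes nothing. [cite: CoatesSujatha2005, §3 statement (A)]
[cite: Kato2004Asterisque, §17.13 (pp. 279–280)] -/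
theorem upperNonSurjFive_body_of_conjA_onDomain
    (hJs : thm61_splitMultiplicative) (hJn : thm61_nonsplitMultiplicative)
    (hGZK : rank_eq_analyticRank_of_analyticRank_le_one) (hpar : nonempty_modularParametrizationData)
    (hGS : ∀ (W : WeierstrassCurve ℚ) [W.IsElliptic] [W.IsGloballyMinimal] (p : ℕ) [Fact p.Prime],
      greenberg_stevens (W := W) (p := p))
    (h12 : Kato2004.thm12_4)
    (hns : Kato2004.exists_multDivisibilityInputs_nonsplit)
    (hsp : Kato2004.exists_multDivisibilityInputs_split)
    (h15 : thm15_isTorsion_multiplicative_rat)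
    (h18 : Wuthrich2014.corollary18_padicLFunction_mem_iwasawaAlgebra_multiplicative)
    (hfine : Kato2004.exists_multDivisibilityInputs_fine)
    (hA : ∀ (W : WeierstrassCurve ℚ) [W.IsElliptic] [W.IsGloballyMinimal] (p : ℕ) [Fact p.Prime],
      ClassX11a W p → ¬ Surj W p → 5 ≤ p → ConjAAt W p) :
    ∀ (W : WeierstrassCurve ℚ) [W.IsElliptic] [W.IsGloballyMinimal] (p : ℕ) [Fact p.Prime],
      ClassX11a W p → ¬ Surj W p → 5 ≤ p → MissingUpperBoundAt W p :=
  fun W _ _ p _ hX hnsj hp5 ↦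
    ClassX11a.missingUpperBoundAt_of_conjAAt hJs hJn hGZK hpar h12 hns hsp h15 h18 hfine W p (hGS W p) hX
      (hA W p hX hnsj hp5)

end OnClass

end Summit.BirchSwinnertonDyer.Rank1Residual.X11b

end
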